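import Literature.NumberTheory.Automorphic.SiegelReducedFamilies
import Literature.NumberTheory.Automorphic.AdelicGLnGlue
import Mathlib.Analysis.Convex.Contractible
import Mathlib.Analysis.Convex.Hull
import Mathlib.Analysis.Convex.Topology
import Mathlib.Analysis.Matrix.Order
import HarnessLib

/-!
# Assembly of the Borel–Serre finite-dimensionality theorem — lemmas
# (stub `stub_borelSerre_assembly` of line `Sketch`, part 1)

Crux `HeckeEigenvalueField` (stmt-Langlands-13632).  The Čech-nerve proof of the Borel–Serre
finite-dimensionality of `H^q(Γ_U, A)` for congruence subgroups `Γ_U ≤ GL_n(K)` covers the cone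
`X ⊆ M_n(K ⊗ ℝ)` of matrices which are positive definite at every place by the translates, under
`g • H = g H gᴴ`, of the CONVEX HULL `V` of the set of matrices with Siegel-reduced family of places
(`SiegelFamily.IsReduced`, `SiegelFamily.placeFamily`).  This file collects the elementary inputs of
that assembly which do not mention reduction theory:

* the action `M ↦ g M gᴴ` of `GL_m(R)` on `M_m(R)` (`R` a commutative `⋆`-ring): composition,
  `ℝ`-linearity, continuity, and the computation `(h⁻¹ g)(h⁻¹ g)ᴴ = 1` when `g gᴴ = h hᴴ`
  (`assembly_mul_conjTranspose_eq_one_of_eq`);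
* RELATIVE OPENNESS OF CONVEX HULLS (`assembly_convexHull_inter_relOpen`): in a real topological
  vector space, the convex hull of the trace `S ∩ O` of an open set `O` on a linear subspace `S` is
  again the trace `S ∩ O'` of an open set (the hull is open in the subspace topology of `S`, Mathlib
  `IsOpen.convexHull`, and the inclusion is linear);
* CONTRACTIBILITY (`assembly_contractibleSpace_subtype_inter`): the trace on a convex set `C` of a
  convex set `T` meeting it is a contractible subspace of `↥C` (Mathlib `Convex.contractibleSpace`);
* over `K ⊗ ℝ = mixedSpace K`: the matrices with Hermitian family of places form an `ℝ`-submodule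
  (`assembly_exists_submodule_placeFamily_isHermitian`) containing the cone
  (`assembly_placeFamily_isHermitian_of_cone`), and `1` lies in the cone (`assembly_one_mem_cone`).

## References

* A. Borel, J.-P. Serre, *Corners and arithmetic groups*, Comment. Math. Helv. 48 (1973), §11.1
  [BorelSerre1973].
* A. Borel, *Introduction aux groupes arithmétiques*, Hermann (1969), §12–§13 [Borel1969].
* A. Hatcher, *Algebraic Topology*, Cambridge University Press (2002), §2.1 [HatcherAT2002].
-/

noncomputable section

set_option linter.dupNamespace false -- project-wide: `Summit.Langlands.Langlands` is the mandated namespace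

open scoped Classical Pointwise ComplexOrder Matrix
open NumberField NumberField.mixedEmbedding Literature.NumberTheory.Automorphic

namespace Summit.Langlands.Langlands.Theorems.HeckeEigenvalueField.Res

/-! ### The action `M ↦ g M gᴴ` -/

section Action

variable {m : Type*} [Fintype m] [DecidableEq m] {R : Type*} [CommRing R] [StarRing R]

/-- `(g h) M (g h)ᴴ = g (h M hᴴ) gᴴ`. [folklore] -/
theorem assembly_act_mul (g h : GL m R) (M : Matrix m m R) :
    ((g * h : GL m R) : Matrix m m R) * M * ((g * h : GL m R) : Matrix m m R)ᴴ =
      (g : Matrix m m R) * ((h : Matrix m m R) * M * (h : Matrix m m R)ᴴ) *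
        (g : Matrix m m R)ᴴ := by
  rw [Units.val_mul, Matrix.conjTranspose_mul]
  simp only [Matrix.mul_assoc]

/-- **If `g gᴴ = h hᴴ` then `h⁻¹ g` stabilises `1`: `(h⁻¹ g)(h⁻¹ g)ᴴ = 1`.** [folklore] -/
theorem assembly_mul_conjTranspose_eq_one_of_eq {g h : GL m R}
    (hgh : (g : Matrix m m R) * (g : Matrix m m R)ᴴ = (h : Matrix m m R) * (h : Matrix m m R)ᴴ) :
    ((h⁻¹ * g : GL m R) : Matrix m m R) * ((h⁻¹ * g : GL m R) : Matrix m m R)ᴴ = 1 := by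
  rw [Units.val_mul, Matrix.conjTranspose_mul, Matrix.mul_assoc,
    ← Matrix.mul_assoc (g : Matrix m m R), hgh, ← Matrix.mul_assoc, ← Matrix.mul_assoc,
    ← Units.val_mul, inv_mul_cancel, Units.val_one, Matrix.one_mul, ← Matrix.conjTranspose_mul,
    ← Units.val_mul, inv_mul_cancel, Units.val_one, Matrix.conjTranspose_one]

/-- The action `M ↦ g M gᴴ` is `ℝ`-linear (for an `ℝ`-algebra `R`). [folklore] -/
theorem assembly_isLinearMap_act [Algebra ℝ R] (g : GL m R) :
    IsLinearMap ℝ fun M : Matrix m m R => (g : Matrix m m R) * M * (g : Matrix m m R)ᴴ :=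
  ⟨fun M N => by rw [Matrix.mul_add, Matrix.add_mul],
    fun r M => by rw [Matrix.mul_smul, Matrix.smul_mul]⟩

/-- The action `M ↦ g M gᴴ` is continuous (for a topological `⋆`-ring `R`). [folklore] -/
theorem assembly_continuous_act [TopologicalSpace R] [IsTopologicalRing R] [ContinuousStar R]
    (g : GL m R) :
    Continuous fun M : Matrix m m R => (g : Matrix m m R) * M * (g : Matrix m m R)ᴴ :=
  (continuous_const.matrix_mul continuous_id).matrix_mul continuous_const

end Action

/-! ### Convexity: relative openness of hulls and contractibility of traces -/

section Convexity

/-- **The convex hull of the trace of an open set on a linear subspace is the trace of an open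
set**: for a submodule `S` of a real topological vector space and an open `O`,
`convexHull ℝ (S ∩ O) = S ∩ O'` for some open `O'` (the hull of the open subset `S ∩ O` of the
topological vector space `↥S` is open in `↥S`, and the inclusion `↥S → F` is linear, so it commutes
with convex hulls). [folklore] -/
theorem assembly_convexHull_inter_relOpen {F : Type*} [AddCommGroup F] [Module ℝ F]
    [TopologicalSpace F] [IsTopologicalAddGroup F] [ContinuousSMul ℝ F]
    (S : Submodule ℝ F) {O : Set F} (hO : IsOpen O) :
    ∃ O' : Set F, IsOpen O' ∧ convexHull ℝ ((S : Set F) ∩ O) = (S : Set F) ∩ O' := by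
  set A : Set S := ((↑) : S → F) ⁻¹' O
  have hA : IsOpen A := hO.preimage continuous_subtype_val
  have hH : IsOpen (convexHull ℝ A) := hA.convexHull
  obtain ⟨O', hO', hpre⟩ := isOpen_induced_iff.mp hH
  refine ⟨O', hO', ?_⟩
  have key : ∀ t : Set F, ((↑) : S → F) '' (((↑) : S → F) ⁻¹' t) = (S : Set F) ∩ t :=
    fun t => Subtype.image_preimage_coe (S : Set F) t
  have h1 : ((↑) : S → F) '' convexHull ℝ A = convexHull ℝ ((S : Set F) ∩ O) := by
    rw [← key]
    exact LinearMap.image_convexHull S.subtype A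
  rw [← h1, ← hpre, key]

/-- **The trace on a convex set of a convex set meeting it is contractible**: for convex
`C, T ⊆ F` with `C ∩ T ≠ ∅`, the subspace `{x : ↥C | ↑x ∈ T}` of `↥C` is contractible (it is
homeomorphic to the non-empty convex set `C ∩ T`). [cite: HatcherAT2002, §2.1] -/
theorem assembly_contractibleSpace_subtype_inter {F : Type*} [AddCommGroup F] [Module ℝ F]
    [TopologicalSpace F] [IsTopologicalAddGroup F] [ContinuousSMul ℝ F] {C T : Set F}
    (hC : Convex ℝ C) (hT : Convex ℝ T) (hne : ∃ x : ↥C, (x : F) ∈ T) :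
    ContractibleSpace ↥{x : ↥C | (x : F) ∈ T} := by
  haveI : ContractibleSpace ↥(C ∩ T) := by
    obtain ⟨x, hx⟩ := hne
    exact (hC.inter hT).contractibleSpace ⟨x, x.2, hx⟩
  let e : ↥{x : ↥C | (x : F) ∈ T} ≃ₜ ↥(C ∩ T) :=
    { toFun := fun x => ⟨(x : ↥C), x.1.2, x.2⟩
      invFun := fun y => ⟨⟨y, y.2.1⟩, y.2.2⟩
      left_inv := fun _ => rfl
      right_inv := fun _ => rfl
      continuous_toFun := (continuous_subtype_val.comp continuous_subtype_val).subtype_mk _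
      continuous_invFun := (continuous_subtype_val.subtype_mk _).subtype_mk _ }
  exact e.contractibleSpace

end Convexity

/-! ### Matrices over `K ⊗ ℝ = mixedSpace K` -/

section MixedSpace

variable (n : ℕ) (K : Type) [Field K]

/-- **The matrices over `mixedSpace K` with Hermitian family of places form an `ℝ`-submodule**
(`placeFamily` is `ℝ`-linear and real multiples of Hermitian matrices are Hermitian). [folklore] -/
theorem assembly_exists_submodule_placeFamily_isHermitian :
    ∃ S : Submodule ℝ (Matrix (Fin n) (Fin n) (mixedSpace K)),
      (S : Set (Matrix (Fin n) (Fin n) (mixedSpace K))) =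
        {H | ∀ w, (SiegelFamily.placeFamily K H w).IsHermitian} := by
  refine ⟨{ carrier := {H | ∀ w, (SiegelFamily.placeFamily K H w).IsHermitian}
            add_mem' := fun {a b} ha hb w => ?_
            zero_mem' := fun w => ?_
            smul_mem' := fun r H hH w => ?_ }, rfl⟩
  · rw [SiegelFamily.placeFamily_add]
    exact (ha w).add (hb w)
  · rw [show SiegelFamily.placeFamily K (0 : Matrix (Fin n) (Fin n) (mixedSpace K)) = 0 from
      (SiegelFamily.placeFamilyₗ K n).map_zero]
    exact Matrix.isHermitian_zero
  · have hH' : ∀ w, (SiegelFamily.placeFamily K H w).IsHermitian := hH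
    rw [SiegelFamily.placeFamily_smul, Pi.smul_apply]
    unfold Matrix.IsHermitian
    rw [Matrix.conjTranspose_smul, star_trivial, (hH' w).eq]

/-- **The cone lies in the Hermitian families**: a matrix over `mixedSpace K` which is positive
definite at every real and every complex place is self-adjoint, so its family of places consists
of Hermitian matrices. [folklore] -/
theorem assembly_placeFamily_isHermitian_of_cone {H : Matrix (Fin n) (Fin n) (mixedSpace K)}
    (hR : ∀ w, (H.map (mixedSpaceEvalReal K w)).PosDef)
    (hC : ∀ w, (H.map (mixedSpaceEvalComplex K w)).PosDef) (w : InfinitePlace K) :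
    (SiegelFamily.placeFamily K H w).IsHermitian := by
  -- `H` is self-adjoint, place by place
  have hsa : Hᴴ = H := by
    refine mixedSpace_matrix_ext n K (fun v => ?_) (fun v => ?_)
    · rw [Matrix.conjTranspose_map (mixedSpaceEvalReal K v) (fun _ => rfl)]
      exact (hR v).isHermitian
    · rw [Matrix.conjTranspose_map (mixedSpaceEvalComplex K v) (fun _ => rfl)]
      exact (hC v).isHermitian
  by_cases hw : w.IsReal
  · rw [SiegelFamily.placeFamily_apply_of_isReal H hw]
    unfold Matrix.IsHermitian
    rw [← Matrix.conjTranspose_map (fun x : mixedSpace K => ((x.1 ⟨w, hw⟩ : ℝ) : ℂ)) (fun x => ?_),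
      hsa]
    change (((star x).1 ⟨w, hw⟩ : ℝ) : ℂ) = (starRingEnd ℂ) (((x.1 ⟨w, hw⟩ : ℝ) : ℂ))
    rw [Complex.conj_ofReal]
    rfl
  · have hc : w.IsComplex := InfinitePlace.not_isReal_iff_isComplex.mp hw
    rw [SiegelFamily.placeFamily_apply_of_isComplex H hc]
    unfold Matrix.IsHermitian
    rw [← Matrix.conjTranspose_map (fun x : mixedSpace K => x.2 ⟨w, hc⟩) (fun x => rfl), hsa]

/-- **`1` lies in the cone**: the identity matrix over `mixedSpace K` is positive definite at every
place. [folklore] -/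
theorem assembly_one_mem_cone :
    (∀ w, ((1 : Matrix (Fin n) (Fin n) (mixedSpace K)).map (mixedSpaceEvalReal K w)).PosDef) ∧
      ∀ w, ((1 : Matrix (Fin n) (Fin n) (mixedSpace K)).map
        (mixedSpaceEvalComplex K w)).PosDef := by
  refine ⟨fun w => ?_, fun w => ?_⟩
  · rw [Matrix.map_one _ (map_zero _) (map_one _)]
    exact Matrix.PosDef.one
  · rw [Matrix.map_one _ (map_zero _) (map_one _)]
    exact Matrix.PosDef.one

end MixedSpace

end Summit.Langlands.Langlands.Theorems.HeckeEigenvalueField.Res
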